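import Mathlib
import Summits.QuantumFields.QCD.Theorems.QuarksAsStableActionWilsonQuarkStabilityTangentAlgebra

/-!
# Infrared determinant perturbation bound for coercive matrices
(helper for crux stmt-QuantumFields-9734, line `Sketch`, stub `stub_detPerturbIR`)

Abstract finite-dimensional linear algebra over `ℂ` (no lattice objects).  For a COERCIVE square
matrix `B` (`c Σ_i ‖v i‖² ≤ Σ_i ‖(B v) i‖²` for all `v`, `c > 0`) and any perturbation `Δ`:

  `‖det (B + Δ)‖ ≤ ‖det B‖ · exp (√(n/c) ‖Δ‖_F + ‖Δ‖_F² / (2c))`,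

`n = |ι|`, `‖Δ‖_F² = Σ_{ij} ‖Δ i j‖²`.

Route: the sibling line's landed tangent inequality
`WilsonQuarkStability.FreeTangentLandauChessboard.norm_det_sq_le_exp_trace_mul`
(`‖det D‖² ≤ exp (Re Tr((D₀ᴴD₀)⁻¹ DᴴD) − n) ‖det D₀‖²`) with `D = B + Δ`, `D₀ = B`, its expansion
`re_trace_gram_inv_mul_gram_sub_card`
(`Re Tr((BᴴB)⁻¹ DᴴD) − n = 2 Re Tr(B⁻¹Δ) + Re Tr((BᴴB)⁻¹ ΔᴴΔ)`), and the coercivity bounds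
`Σ‖(B⁻¹ w) i‖² ≤ Σ‖w i‖²/c` and (for the adjoint, by Cauchy–Schwarz) `Σ‖((B⁻¹)ᴴ w) i‖² ≤ Σ‖w i‖²/c`,
whence `Re Tr(B⁻¹Δ) ≤ √n ‖B⁻¹Δ‖_F ≤ √(n/c) ‖Δ‖_F` and
`Re Tr((BᴴB)⁻¹ ΔᴴΔ) = ‖Δ B⁻¹‖_F² ≤ ‖Δ‖_F²/c`; finally take square roots.

Pure theorem file (no definitions); Mathlib + the sibling TangentAlgebra file only.
-/

noncomputable section

open scoped BigOperators Classical Matrix ComplexConjugate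
open Finset

namespace Summit.QuantumFields.QCD.Cruxes.CriticalLineDiamagnetism.ChessboardCellGain

namespace StubDetPerturbIRAux

open Matrix Complex
open Summit.QuantumFields.QCD.Cruxes.WilsonQuarkStability.FreeTangentLandauChessboard

variable {ι : Type} [Fintype ι] [DecidableEq ι]

/-- Coercivity `c Σ‖v i‖² ≤ Σ‖(B v) i‖²` with `c > 0` forces `det B ≠ 0`. -/
theorem det_ne_zero_of_coercive (B : Matrix ι ι ℂ) {c : ℝ} (hc : 0 < c)
    (hB : ∀ v : ι → ℂ, c * ∑ i, ‖v i‖ ^ 2 ≤ ∑ i, ‖(B.mulVec v) i‖ ^ 2) : B.det ≠ 0 := by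
  intro hdet
  obtain ⟨v, hv, hBv⟩ := (Matrix.exists_mulVec_eq_zero_iff (M := B)).mpr hdet
  have h := hB v
  rw [hBv] at h
  simp only [Pi.zero_apply, norm_zero, ne_eq, OfNat.ofNat_ne_zero, not_false_eq_true, zero_pow,
    Finset.sum_const_zero] at h
  have hS : ∑ i, ‖v i‖ ^ 2 = 0 := by
    have h0 : 0 ≤ ∑ i, ‖v i‖ ^ 2 := by positivity
    by_contra hne
    have hpos : 0 < ∑ i, ‖v i‖ ^ 2 := lt_of_le_of_ne h0 (Ne.symm hne)
    have := mul_pos hc hpos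
    linarith
  apply hv
  funext i
  have hi := (Finset.sum_eq_zero_iff_of_nonneg (fun i _ => by positivity)).mp hS i (Finset.mem_univ i)
  simpa using hi

/-- Coercivity bounds the inverse with the same constant: `Σ‖(B⁻¹ w) i‖² ≤ Σ‖w i‖² / c`. -/
theorem sum_norm_sq_inv_mulVec_le (B : Matrix ι ι ℂ) {c : ℝ} (hc : 0 < c)
    (hB : ∀ v : ι → ℂ, c * ∑ i, ‖v i‖ ^ 2 ≤ ∑ i, ‖(B.mulVec v) i‖ ^ 2) (w : ι → ℂ) :
    ∑ i, ‖(B⁻¹ *ᵥ w) i‖ ^ 2 ≤ (∑ i, ‖w i‖ ^ 2) / c := by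
  have hU : IsUnit B.det := isUnit_iff_ne_zero.mpr (det_ne_zero_of_coercive B hc hB)
  have h := hB (B⁻¹ *ᵥ w)
  rw [mulVec_mulVec, mul_nonsing_inv _ hU, one_mulVec] at h
  rw [le_div_iff₀ hc, mul_comm]
  exact h

/-- Coercivity bounds the ADJOINT inverse with the same constant: `Σ‖((B⁻¹)ᴴ v) i‖² ≤ Σ‖v i‖² / c`
(`‖(B⁻¹)ᴴ v‖² = Re ⟨v, B⁻¹ (B⁻¹)ᴴ v⟩ ≤ ‖v‖ · c^{-1/2} ‖(B⁻¹)ᴴ v‖`). -/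
theorem sum_norm_sq_conjTranspose_inv_mulVec_le (B : Matrix ι ι ℂ) {c : ℝ} (hc : 0 < c)
    (hB : ∀ v : ι → ℂ, c * ∑ i, ‖v i‖ ^ 2 ≤ ∑ i, ‖(B.mulVec v) i‖ ^ 2) (v : ι → ℂ) :
    ∑ i, ‖((B⁻¹)ᴴ *ᵥ v) i‖ ^ 2 ≤ (∑ i, ‖v i‖ ^ 2) / c := by
  set u : ι → ℂ := (B⁻¹)ᴴ *ᵥ v with hu
  -- `‖u‖² = Re ⟨v, B⁻¹ u⟩`
  have hkey : (∑ i, ‖u i‖ ^ 2 : ℝ) = (star v ⬝ᵥ (B⁻¹ *ᵥ u)).re := by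
    have h1 : star v ⬝ᵥ (B⁻¹ *ᵥ u) = star u ⬝ᵥ u := by
      rw [dotProduct_mulVec, hu, star_mulVec, conjTranspose_conjTranspose]
    rw [h1]
    simp only [dotProduct, Pi.star_apply, Complex.star_def, Complex.re_sum, Complex.conj_mul']
    refine Finset.sum_congr rfl fun i _ => ?_
    rw [← Complex.ofReal_pow, Complex.ofReal_re]
  -- Cauchy–Schwarz
  have hCS : (star v ⬝ᵥ (B⁻¹ *ᵥ u)).re ≤
      Real.sqrt (∑ i, ‖v i‖ ^ 2) * Real.sqrt (∑ i, ‖(B⁻¹ *ᵥ u) i‖ ^ 2) := by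
    refine (Complex.re_le_norm _).trans ?_
    simp only [dotProduct]
    refine (norm_sum_le _ _).trans ?_
    simp only [norm_mul, Pi.star_apply, norm_star]
    exact Real.sum_mul_le_sqrt_mul_sqrt _ _ _
  have hinv := sum_norm_sq_inv_mulVec_le B hc hB u
  have hSu0 : 0 ≤ ∑ i, ‖u i‖ ^ 2 := by positivity
  have hSv0 : 0 ≤ ∑ i, ‖v i‖ ^ 2 := by positivity
  have hle : ∑ i, ‖u i‖ ^ 2 ≤
      Real.sqrt (∑ i, ‖v i‖ ^ 2) * Real.sqrt ((∑ i, ‖u i‖ ^ 2) / c) :=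
    calc ∑ i, ‖u i‖ ^ 2 = (star v ⬝ᵥ (B⁻¹ *ᵥ u)).re := hkey
      _ ≤ Real.sqrt (∑ i, ‖v i‖ ^ 2) * Real.sqrt (∑ i, ‖(B⁻¹ *ᵥ u) i‖ ^ 2) := hCS
      _ ≤ Real.sqrt (∑ i, ‖v i‖ ^ 2) * Real.sqrt ((∑ i, ‖u i‖ ^ 2) / c) :=
        mul_le_mul_of_nonneg_left (Real.sqrt_le_sqrt hinv) (Real.sqrt_nonneg _)
  -- square it
  have hsq : (∑ i, ‖u i‖ ^ 2) ^ 2 ≤ (∑ i, ‖v i‖ ^ 2) * ((∑ i, ‖u i‖ ^ 2) / c) := by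
    have h2 : (∑ i, ‖u i‖ ^ 2) ^ 2 ≤
        (Real.sqrt (∑ i, ‖v i‖ ^ 2) * Real.sqrt ((∑ i, ‖u i‖ ^ 2) / c)) ^ 2 :=
      pow_le_pow_left₀ hSu0 hle 2
    rwa [mul_pow, Real.sq_sqrt hSv0, Real.sq_sqrt (div_nonneg hSu0 hc.le)] at h2
  rcases hSu0.eq_or_lt with h0 | hpos
  · rw [← h0]; positivity
  · rw [le_div_iff₀ hc]
    have h3 : (∑ i, ‖u i‖ ^ 2) * ((∑ i, ‖u i‖ ^ 2) * c) ≤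
        (∑ i, ‖u i‖ ^ 2) * ∑ i, ‖v i‖ ^ 2 :=
      calc (∑ i, ‖u i‖ ^ 2) * ((∑ i, ‖u i‖ ^ 2) * c) = (∑ i, ‖u i‖ ^ 2) ^ 2 * c := by ring
        _ ≤ (∑ i, ‖v i‖ ^ 2) * ((∑ i, ‖u i‖ ^ 2) / c) * c :=
          mul_le_mul_of_nonneg_right hsq hc.le
        _ = (∑ i, ‖u i‖ ^ 2) * ∑ i, ‖v i‖ ^ 2 := by
          rw [mul_assoc, div_mul_cancel₀ _ hc.ne', mul_comm]
    exact le_of_mul_le_mul_left h3 hpos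

/-- **First-order term**: `Re Tr(B⁻¹ Δ) ≤ √(n/c) · ‖Δ‖_F` for coercive `B`
(`Re Tr M ≤ Σ_j ‖M j j‖ ≤ √n ‖M‖_F`, and `‖B⁻¹Δ‖_F² ≤ ‖Δ‖_F²/c` column by column). -/
theorem re_trace_inv_mul_le (B Δ : Matrix ι ι ℂ) {c : ℝ} (hc : 0 < c)
    (hB : ∀ v : ι → ℂ, c * ∑ i, ‖v i‖ ^ 2 ≤ ∑ i, ‖(B.mulVec v) i‖ ^ 2) :
    (B⁻¹ * Δ).trace.re ≤
      Real.sqrt (Fintype.card ι / c) * Real.sqrt (∑ i, ∑ j, ‖Δ i j‖ ^ 2) := by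
  -- columnwise Frobenius bound on `B⁻¹ Δ`
  have hcol : ∀ j, ∑ i, ‖(B⁻¹ * Δ) i j‖ ^ 2 ≤ (∑ i, ‖Δ i j‖ ^ 2) / c := fun j => by
    have h := sum_norm_sq_inv_mulVec_le B hc hB (fun i => Δ i j)
    simpa only [mulVec, dotProduct, mul_apply] using h
  have hfrob : ∑ j, ∑ i, ‖(B⁻¹ * Δ) i j‖ ^ 2 ≤ (∑ i, ∑ j, ‖Δ i j‖ ^ 2) / c :=
    calc ∑ j, ∑ i, ‖(B⁻¹ * Δ) i j‖ ^ 2 ≤ ∑ j, (∑ i, ‖Δ i j‖ ^ 2) / c :=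
          Finset.sum_le_sum fun j _ => hcol j
      _ = (∑ i, ∑ j, ‖Δ i j‖ ^ 2) / c := by rw [← Finset.sum_div, Finset.sum_comm]
  have hdiag : ∑ j, ‖(B⁻¹ * Δ) j j‖ ^ 2 ≤ (∑ i, ∑ j, ‖Δ i j‖ ^ 2) / c :=
    le_trans (Finset.sum_le_sum fun j _ =>
      Finset.single_le_sum (f := fun i => ‖(B⁻¹ * Δ) i j‖ ^ 2) (fun i _ => by positivity)
        (Finset.mem_univ j)) hfrob
  calc (B⁻¹ * Δ).trace.re = ∑ j, ((B⁻¹ * Δ) j j).re := by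
        simp only [Matrix.trace, Matrix.diag, Complex.re_sum]
    _ ≤ ∑ j, 1 * ‖(B⁻¹ * Δ) j j‖ :=
        Finset.sum_le_sum fun j _ => by rw [one_mul]; exact Complex.re_le_norm _
    _ ≤ Real.sqrt (∑ _j : ι, (1 : ℝ) ^ 2) * Real.sqrt (∑ j, ‖(B⁻¹ * Δ) j j‖ ^ 2) :=
        Real.sum_mul_le_sqrt_mul_sqrt _ _ _
    _ ≤ Real.sqrt (Fintype.card ι) * Real.sqrt ((∑ i, ∑ j, ‖Δ i j‖ ^ 2) / c) := by
        have h1 : ∑ _j : ι, (1 : ℝ) ^ 2 = Fintype.card ι := by simp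
        rw [h1]
        exact mul_le_mul_of_nonneg_left (Real.sqrt_le_sqrt hdiag) (Real.sqrt_nonneg _)
    _ = Real.sqrt (Fintype.card ι / c) * Real.sqrt (∑ i, ∑ j, ‖Δ i j‖ ^ 2) := by
        rw [← Real.sqrt_mul (Nat.cast_nonneg _),
          ← Real.sqrt_mul (div_nonneg (Nat.cast_nonneg _) hc.le)]
        congr 1
        ring

/-- **Second-order term**: `Re Tr((BᴴB)⁻¹ ΔᴴΔ) ≤ ‖Δ‖_F² / c` for coercive `B`
(`(BᴴB)⁻¹ = B⁻¹(B⁻¹)ᴴ`, so the trace is `‖Δ B⁻¹‖_F²`, bounded row by row through the adjoint bound). -/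
theorem re_trace_gram_inv_mul_le (B Δ : Matrix ι ι ℂ) {c : ℝ} (hc : 0 < c)
    (hB : ∀ v : ι → ℂ, c * ∑ i, ‖v i‖ ^ 2 ≤ ∑ i, ‖(B.mulVec v) i‖ ^ 2) :
    ((Bᴴ * B)⁻¹ * (Δᴴ * Δ)).trace.re ≤ (∑ i, ∑ j, ‖Δ i j‖ ^ 2) / c := by
  -- rewrite the trace as `‖Δ B⁻¹‖_F²`
  have hG : (Bᴴ * B)⁻¹ = B⁻¹ * (B⁻¹)ᴴ := by
    rw [Matrix.mul_inv_rev, ← conjTranspose_nonsing_inv]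
  have htr : ((Bᴴ * B)⁻¹ * (Δᴴ * Δ)).trace = ((Δ * B⁻¹) * (Δ * B⁻¹)ᴴ).trace := by
    rw [hG, ← Matrix.mul_assoc, trace_mul_cycle (B⁻¹ * (B⁻¹)ᴴ) Δᴴ Δ, conjTranspose_mul]
    simp only [Matrix.mul_assoc]
  have htr2 : ∀ P : Matrix ι ι ℂ, (P * Pᴴ).trace.re = ∑ i, ∑ j, ‖P i j‖ ^ 2 := fun P => by
    simp only [Matrix.trace, Matrix.diag, Matrix.mul_apply, conjTranspose_apply, Complex.star_def,
      Complex.re_sum, Complex.mul_conj']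
    refine Finset.sum_congr rfl fun i _ => Finset.sum_congr rfl fun j _ => ?_
    rw [← Complex.ofReal_pow, Complex.ofReal_re]
  rw [htr, htr2]
  -- row bound through the adjoint
  have hrow : ∀ i, ∑ j, ‖(Δ * B⁻¹) i j‖ ^ 2 ≤ (∑ j, ‖Δ i j‖ ^ 2) / c := fun i => by
    have h := sum_norm_sq_conjTranspose_inv_mulVec_le B hc hB (star fun j => Δ i j)
    rw [← star_vecMul] at h
    simpa only [Pi.star_apply, norm_star, vecMul, dotProduct, mul_apply] using h
  calc ∑ i, ∑ j, ‖(Δ * B⁻¹) i j‖ ^ 2 ≤ ∑ i, (∑ j, ‖Δ i j‖ ^ 2) / c :=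
        Finset.sum_le_sum fun i _ => hrow i
    _ = (∑ i, ∑ j, ‖Δ i j‖ ^ 2) / c := by rw [Finset.sum_div]

end StubDetPerturbIRAux

open StubDetPerturbIRAux
  Summit.QuantumFields.QCD.Cruxes.WilsonQuarkStability.FreeTangentLandauChessboard in
/-- **Stub 3b — `detPerturbIR`.**  If `B` is coercive, `c Σ‖v i‖² ≤ Σ‖(B v) i‖²` (`c > 0`), then for
every perturbation `Δ`: `‖det(B + Δ)‖ ≤ ‖det B‖ · exp(√(n/c)·‖Δ‖_F + ‖Δ‖_F²/(2c))`
(`n = |ι|`, `‖Δ‖_F² = Σ_{ij} ‖Δ_{ij}‖²`).  From the tangent inequality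
`norm_det_sq_le_exp_trace_mul` with `D = B + Δ`, `D₀ = B`, the expansion
`re_trace_gram_inv_mul_gram_sub_card`, and the two coercivity trace bounds above. -/
theorem stub_detPerturbIR :
    ∀ {ι : Type} [Fintype ι] [DecidableEq ι] (B Δ : Matrix ι ι ℂ) (c : ℝ), 0 < c →
      (∀ v : ι → ℂ, c * ∑ i, ‖v i‖ ^ 2 ≤ ∑ i, ‖(B.mulVec v) i‖ ^ 2) →
      ‖(B + Δ).det‖ ≤ ‖B.det‖ *
        Real.exp (Real.sqrt (Fintype.card ι / c) * Real.sqrt (∑ i, ∑ j, ‖Δ i j‖ ^ 2) +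
          (∑ i, ∑ j, ‖Δ i j‖ ^ 2) / (2 * c)) := by
  intro ι _ _ B Δ c hc hB
  have hdet : B.det ≠ 0 := det_ne_zero_of_coercive B hc hB
  have hA0 := norm_det_sq_le_exp_trace_mul (B + Δ) B hdet
  have hexp := re_trace_gram_inv_mul_gram_sub_card (B + Δ) B hdet
  rw [add_sub_cancel_left] at hexp
  have h1 := re_trace_inv_mul_le B Δ hc hB
  have h2 := re_trace_gram_inv_mul_le B Δ hc hB
  set F : ℝ := ∑ i, ∑ j, ‖Δ i j‖ ^ 2 with hF
  have key : 2 * (F / (2 * c)) = F / c := by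
    rw [← mul_div_assoc, mul_div_mul_left F c two_ne_zero]
  have hexple : ((Bᴴ * B)⁻¹ * ((B + Δ)ᴴ * (B + Δ))).trace.re - Fintype.card ι ≤
      2 * (Real.sqrt (Fintype.card ι / c) * Real.sqrt F + F / (2 * c)) := by
    linarith [hexp, h1, h2, key]
  have hsq : ‖(B + Δ).det‖ ^ 2 ≤
      (‖B.det‖ * Real.exp (Real.sqrt (Fintype.card ι / c) * Real.sqrt F + F / (2 * c))) ^ 2 :=
    calc ‖(B + Δ).det‖ ^ 2 ≤ _ := hA0
      _ ≤ Real.exp (2 * (Real.sqrt (Fintype.card ι / c) * Real.sqrt F + F / (2 * c))) *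
            ‖B.det‖ ^ 2 :=
          mul_le_mul_of_nonneg_right (Real.exp_le_exp.mpr hexple) (sq_nonneg _)
      _ = (‖B.det‖ * Real.exp (Real.sqrt (Fintype.card ι / c) * Real.sqrt F + F / (2 * c))) ^ 2 := by
          rw [two_mul, Real.exp_add]
          ring
  exact le_of_sq_le_sq hsq (by positivity)

end Summit.QuantumFields.QCD.Cruxes.CriticalLineDiamagnetism.ChessboardCellGain

end
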